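import Literature.AlgebraicGeometry.Resolution.WeightedCentreVertexPreparation
import HarnessLib

/-!
# The twisted count on a Hironaka-normalised `δ`-face: (N0) weakened to (N0_W)

Companion (REV. 5 content) to `WeightedCentreVertexPreparation.lean` (§10 there), kept in a separate
file only because the parent file sits at the 200 000-byte cap; the private helper lemmas of its
§§2, 7–10 that the proof needs are DUPLICATED here verbatim (private, `[folklore]`), nothing in the
parent file is changed.

[CJS20] Cossart–Jannsen–Saito, *Desingularization: Invariants and Strategy*, LNM 2270 (2020):
Def. 8.2 (4) (p. 118: `in_δ`, the `δ`-face), Def. 8.13 (pp. 120–121: solvable vertices, the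
translations `Y ↦ Y + λ(U)`), Thm. 8.16 (p. 121; = [H3] Hironaka, *Characteristic polyhedra of
singularities*, J. Math. Kyoto Univ. 7 (1967), Thm. (4.8): prepared vertices persist), Thm. 8.22 (a)
(p. 124: "Any solution for (f, y, u) at v is of the form λ with λ_i = c_i U^v"), Thm. 8.24 (p. 125:
`δ`-preparation by `y`-translations); [ATW24] Abramovich–Temkin–Włodarczyk, Algebra & Number Theory 18
(2024), Thm. 5.3.1 (p. 1578); [AQS25] Abramovich–Quek–Schober, Thm. 3.5.

POLYNOMIAL MODEL and notation exactly as in the parent file: `ν = ord f`, `in_ν f ∈ k[X_S]`,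
`|S| = τ(in_ν f)`, `(y, u) = (X_S, X_{Sᶜ})`, `δ = δ(f; u; y)` (`hironakaDelta`), `(f; y; u)` `δ`-prepared
(`IsDeltaPrepared`), a centre `(Ψ; γ)` for `f` (`IsCentreFor`), the twists `Φ_i = uHomogeneousPart S δ
(Ψ (X i))`, the competitor's forms `T(Ψ, γ)` (`competitorSpan`), `in_δ f` (`deltaInitial`).

DEFINED here: `predFaceSlice S ν δ f e = N_e ∈ k[X_S]_{ν−1}` — the `U^e`-coefficient of the
`y`-degree-`(ν−1)` part `N = Σ_{|B| = ν−1, |A| = δ} c_{A,B} y^B u^A = Σ_e N_e U^e` of the `δ`-face of `f`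
[Def. 8.2 (4)]; (N0) of the parent file is `N = 0`.

PROVED here — statements and proofs OURS, in the model:
* `uHomogeneousPart_mem_linearFormsSubalgebra_of_disjoint` — `δ`-prepared, (IND) the partials
  `∂_l in_ν f` (`l ∈ S`) linearly independent, and (N0_W) `span_k {∂_l in_ν f} ∩ span_k {N_e} = 0`:
  then for every centre `(Ψ; γ)` with `γ = 1/ν` on `S`, `γ ≤ 1/(νδ)` off `S`, every twist `Φ_i` lies in
  `k[T(Ψ, γ)]`; proof = the parent's §10 argument (grade `in_δ f = (in_w Ψ⁻¹f)(in_w z)` by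
  `X_S`-degree; top slice `in_ν f = H_ν(Lin)`; next slice `N = Σ_i Φ_i (∂_i H_ν)(Lin) + Rest`; chain
  rule) with the dual functional now taken on the quotient by `span_k {N_e}`
  (`exists_dual_eq_ite_of_disjoint`), so that coefficient extraction along `k[X_S]` kills `N`;
* `hironakaTau_deltaInitial_le_of_disjoint` — hence the COUNT `τ(in_δ f) ≤ |S| + #{j ∉ S : γ_j = 1/(νδ)}`
  for every centre of the class (via the parent's `hironakaTau_deltaInitial_le_of_isCentreFor`);
* `disjoint_span_pderiv_predFaceSlice_of_forall_ne` — (N0) ⇒ (N0_W), so the parent's REV. 4 theorems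
  `…_of_linearIndependent` are the case `N = 0`;
* `weightedHomogeneousComponent_indicator_deltaInitial_eq_sum` — the `X_S`-degree-`(ν−1)` slice of
  `in_δ f` is `N`.
A `y`-translation `Y ↦ Y + λ(U)` with `λ_l ∈ k[U]` homogeneous of degree `δ` (e.g. the solutions
`λ_l = c_l U^v` of Thm. 8.22 (a)) adds `Σ_l λ_{l,e} · ∂_l in_ν f` to the slice `N_e` (`λ_{l,e}` = the
`U^e`-coefficient of `λ_l`): the classes of the `N_e` modulo `span_k {∂_l in_ν f}` are what such
normalising moves cannot change; `N = 0` (N0) is reachable by them iff every `N_e` lies in that span,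
while (N0_W) is the transversal case (it contains (N0), and — like the conclusion `Φ_i ∈ k[T]` itself —
is not preserved by these translations).  For `τ ≥ 2` neither (IND) nor (N0_W) can be dropped even
when `p ∤ ν` (specimens found by the cell's search and checked by two independent scripts; recorded,
not formalised): over `𝔽₂` with `ν = 3`,
`φ = u₁² + u₁u₂ + u₂²`, `r = (u₁ + u₂)⁴`, the `δ`-prepared `f = y₁²y₂ + y₂φ² + y₁r + φr` ((N0) holds,
(IND) fails) and `f = (y₁ + φ)³ + y₂³ + y₂(u₁ + u₂)²(y₁ + φ)` ((IND) holds; `N = y₁²φ + y₁y₂(u₁ + u₂)²`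
has the slice `N_{u₁u₂} = y₁² = ∂_{y₁} in_ν f`, so (N0_W) fails) both have `δ = 2`, `τ(in_δ f) = 4` and
admit the centre `(y₁ ↦ y₁ + φ, u₂ ↦ u₂ + u₁; 1/3, 1/3, w, 1/6)` for every `0 < w < 1/6` — one
`u`-weight `1/(νδ)` where the count demands two.
NOT claimed: anything for general ideals (`m > 1`), formal coordinate changes, a normalisation
PROCEDURE (the statements concern `in_δ` of the GIVEN `f`), the count without (IND)/(N0_W), later
stages of the invariant.
-/

noncomputable section

open MvPolynomial
open Finsupp (weight)

namespace Literature.AlgebraicGeometry.Resolution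

namespace WeightedBlowup

variable {k : Type*} [Field k] {n : ℕ}

/-! ## 1. Helper lemmas duplicated from the parent file (private there and here) -/

section Exponents

variable (S : Finset (Fin n))

/-- `|B| = Σ_{i ∈ S} d i`. [folklore] -/
private theorem blockDeg_eq_sum_univ (d : Fin n →₀ ℕ) :
    blockDeg S d = ∑ i ∈ S, d i := by
  classical
  rw [blockDeg]
  refine (Finset.sum_subset (fun i hi => (Finset.mem_filter.mp hi).2) fun i hiS hi => ?_).trans rfl
  · simpa [Finset.mem_filter, hiS] using hi

/-- `|A| = Σ_{i ∉ S} d i`. [folklore] -/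
private theorem coDeg_eq_sum_univ (d : Fin n →₀ ℕ) :
    coDeg S d = ∑ i ∈ Finset.univ.filter (· ∉ S), d i := by
  classical
  rw [coDeg]
  refine Finset.sum_subset (fun i hi => by simpa using (Finset.mem_filter.mp hi).2)
    fun i hiS hi => ?_
  rw [Finset.mem_filter] at hiS
  simpa [Finset.mem_filter, hiS.2] using hi

end Exponents

section Structure

variable {f : MvPolynomial (Fin n) k} {ν : ℕ} {S : Finset (Fin n)}

/-- The weight of `d` for the block weights `(p on S, q off S)` is `p|B| + q|A|`. [folklore] -/
private theorem weight_block (S : Finset (Fin n)) (p q : ℕ) (d : Fin n →₀ ℕ) :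
    weight (fun i => if i ∈ S then p else q) d = p * blockDeg S d + q * coDeg S d := by
  classical
  rw [Finsupp.weight_apply, Finsupp.sum, blockDeg, coDeg, Finset.mul_sum, Finset.mul_sum,
    ← Finset.sum_filter_add_sum_filter_not d.support (· ∈ S)]
  congr 1
  · refine Finset.sum_congr rfl fun i hi => ?_
    rw [Finset.mem_filter] at hi
    simp [hi.2, mul_comm]
  · refine Finset.sum_congr rfl fun i hi => ?_
    rw [Finset.mem_filter] at hi
    simp [hi.2, mul_comm]

end Structure

section Helpers

variable (S : Finset (Fin n))

/-- Coefficients of a support-restricted sum of the monomials of `g`. [folklore] -/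
private theorem coeff_sum_filter_monomial (P : (Fin n →₀ ℕ) → Prop) [DecidablePred P]
    (g : MvPolynomial (Fin n) k) (d : Fin n →₀ ℕ) :
    coeff d (∑ e ∈ g.support with P e, monomial e (coeff e g)) = if P d then coeff d g else 0 := by
  classical
  rw [coeff_sum]
  simp_rw [coeff_monomial]
  by_cases hP : P d
  · rw [if_pos hP]
    by_cases hd : d ∈ g.support
    · rw [Finset.sum_eq_single_of_mem d (Finset.mem_filter.mpr ⟨hd, hP⟩)
        (fun e _ hne => if_neg hne), if_pos rfl]
    · rw [notMem_support_iff.mp hd]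
      exact Finset.sum_eq_zero fun e he => by
        rw [ite_eq_right_iff]
        rintro rfl
        exact absurd (Finset.mem_filter.mp he).1 hd
  · rw [if_neg hP]
    exact Finset.sum_eq_zero fun e he => by
      rw [ite_eq_right_iff]
      rintro rfl
      exact absurd (Finset.mem_filter.mp he).2 hP

end Helpers

section Main

variable {f : MvPolynomial (Fin n) k} {ν : ℕ} {S : Finset (Fin n)}

/-- `δ(f;u;y) < ∞` forces `ν > 0`. [folklore] -/
private theorem nu_pos_of_hironakaDelta_eq {δ : ℚ} (hδ : hironakaDelta S ν f = δ) : 0 < ν := by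
  rcases Nat.eq_zero_or_pos ν with h0 | h0
  · exfalso
    subst h0
    have htop := (hironakaDelta_eq_top_iff S 0 f).mpr fun d _ => Nat.zero_le _
    rw [htop] at hδ
    exact WithTop.top_ne_coe hδ
  · exact h0

end Main

section Count

variable {f : MvPolynomial (Fin n) k} {ν : ℕ} {S : Finset (Fin n)}

/-- For `i ∉ S` the attached form is `ℓ_i`. [folklore] -/
private theorem linearFormPoly_competitorForm_of_not_mem
    {Ψ : MvPolynomial (Fin n) k ≃ₐ[k] MvPolynomial (Fin n) k} {i : Fin n} (hi : i ∉ S) :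
    linearFormPoly k (competitorForm S Ψ i) = linearFormPoly k (uLinearForm S (Ψ (X i))) := by
  rw [competitorForm, if_neg hi]

/-- The attached forms lie in `k[T(Ψ, γ)]`. [folklore] -/
private theorem linearFormPoly_competitorForm_mem {δ : ℚ}
    {Ψ : MvPolynomial (Fin n) k ≃ₐ[k] MvPolynomial (Fin n) k} {γ : Fin n → ℚ} {i : Fin n}
    (hi : i ∈ S ∪ Finset.univ.filter (fun j => j ∉ S ∧ γ j = ((ν : ℚ) * δ)⁻¹)) :
    linearFormPoly k (competitorForm S Ψ i) ∈ linearFormsSubalgebra k (competitorSpan S ν δ Ψ γ) :=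
  Algebra.subset_adjoin ⟨competitorForm S Ψ i, Submodule.subset_span ⟨⟨i, hi⟩, rfl⟩, rfl⟩

/-- `ℓ_j ∈ k[T(Ψ, γ)]` for `j ∉ S` with `γ_j = 1/(νδ)`. [folklore] -/
private theorem uLinearForm_mem_linearFormsSubalgebra_competitorSpan {δ : ℚ}
    {Ψ : MvPolynomial (Fin n) k ≃ₐ[k] MvPolynomial (Fin n) k} {γ : Fin n → ℚ} {j : Fin n}
    (hj : j ∉ S) (hγj : γ j = ((ν : ℚ) * δ)⁻¹) :
    linearFormPoly k (uLinearForm S (Ψ (X j))) ∈ linearFormsSubalgebra k (competitorSpan S ν δ Ψ γ) := by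
  rw [← linearFormPoly_competitorForm_of_not_mem hj]
  exact linearFormPoly_competitorForm_mem
    (Finset.mem_union_right _ (Finset.mem_filter.mpr ⟨Finset.mem_univ _, hj, hγj⟩))

/-- A positive rational as `p/q` with its canonical numerator and denominator. [folklore] -/
private theorem exists_eq_mul_den {δ : ℚ} (hδ : 0 < δ) : ∃ p q : ℕ, 0 < q ∧ (p : ℚ) = δ * q := by
  obtain ⟨p, hp⟩ := Int.eq_ofNat_of_zero_le (Rat.num_nonneg.mpr hδ.le)
  refine ⟨p, δ.den, δ.den_pos, ?_⟩
  rw [Rat.mul_den_eq_num δ, hp]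
  simp

/-- Taking a weighted homogeneous component commutes with multiplication by a weight-`0` factor. [folklore] -/
private theorem weightedHomogeneousComponent_mul_of_isWeightedHomogeneous_zero {w : Fin n → ℕ}
    {U : MvPolynomial (Fin n) k} (hU : IsWeightedHomogeneous w U 0) (P : MvPolynomial (Fin n) k)
    (m : ℕ) :
    weightedHomogeneousComponent w m (P * U) = weightedHomogeneousComponent w m P * U := by
  classical
  ext d
  rw [coeff_weightedHomogeneousComponent, coeff_mul, coeff_mul]
  have key : ∀ x ∈ Finset.antidiagonal d,
      coeff x.1 (weightedHomogeneousComponent w m P) * coeff x.2 U =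
        if weight w d = m then coeff x.1 P * coeff x.2 U else 0 := by
    intro x hx
    rw [coeff_weightedHomogeneousComponent]
    by_cases hU0 : coeff x.2 U = 0
    · simp [hU0]
    · have h2 : weight w x.2 = 0 := hU hU0
      have hd : weight w d = weight w x.1 := by
        rw [← Finset.mem_antidiagonal.mp hx, map_add, h2, add_zero]
      rw [hd]
      split_ifs <;> simp
  rw [Finset.sum_congr rfl key]
  by_cases hW : weight w d = m <;> simp [hW]

end Count

/-! ## Infrastructure for §10: coefficient extraction along `k[X_S]`, Taylor slices, chain rule -/

section CoeffAlong

variable (S : Finset (Fin n))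

/-- The `S`-part `d|_S` of an exponent. [folklore] -/
private def sPart (d : Fin n →₀ ℕ) : Fin n →₀ ℕ := d.filter fun i => i ∈ S

/-- The `u`-part `d|_{Sᶜ}` of an exponent. [folklore] -/
private def uPart (d : Fin n →₀ ℕ) : Fin n →₀ ℕ := d.filter fun i => i ∉ S

/-- `d = d|_S + d|_{Sᶜ}`. [folklore] -/
private theorem sPart_add_uPart (d : Fin n →₀ ℕ) : sPart S d + uPart S d = d := by
  simp only [sPart, uPart]
  exact Finsupp.filter_add_filter_not d (fun i => i ∈ S)

/-- Coefficient extraction along `k[X_S]`: the `k`-linear map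
`Σ_d c_d X^d ↦ Σ_{d : d|_S = B} c_d X^{d|_{Sᶜ}}`, i.e. the `X_S^B`-coefficient of a polynomial read in
`k[X_{Sᶜ}][X_S]`. [folklore] -/
private def coeffAlong (B : Fin n →₀ ℕ) : MvPolynomial (Fin n) k →ₗ[k] MvPolynomial (Fin n) k :=
  Finsupp.lsum k (fun d : Fin n →₀ ℕ =>
      if sPart S d = B then (monomial (uPart S d) : k →ₗ[k] MvPolynomial (Fin n) k) else 0)
    ∘ₗ (AddMonoidAlgebra.coeffLinearEquiv k).toLinearMap

/-- `coeffAlong` on a monomial. [folklore] -/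
private theorem coeffAlong_monomial (B d : Fin n →₀ ℕ) (c : k) :
    coeffAlong (k := k) S B (monomial d c) = if sPart S d = B then monomial (uPart S d) c else 0 := by
  have : coeffAlong (k := k) S B (monomial d c) =
      (if sPart S d = B then (monomial (uPart S d) : k →ₗ[k] MvPolynomial (Fin n) k) else 0) c :=
    sum_monomial_eq (LinearMap.map_zero _)
  rw [this]
  split_ifs <;> simp

/-- For `D ∈ k[X_S]` and `Φ ∈ k[X_{Sᶜ}]` the `X_S^B`-coefficient of `D · Φ` is `D_B · Φ`. [folklore] -/
private theorem coeffAlong_mul_of_supported {D Φ : MvPolynomial (Fin n) k}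
    (hD : ∀ d ∈ D.support, uPart S d = 0) (hΦ : ∀ d ∈ Φ.support, sPart S d = 0) (B : Fin n →₀ ℕ) :
    coeffAlong S B (D * Φ) = coeff B D • Φ := by
  classical
  conv_lhs => rw [D.as_sum, Φ.as_sum, Finset.sum_mul_sum]
  simp_rw [map_sum]
  have key : ∀ d₁ ∈ D.support, ∀ d₂ ∈ Φ.support,
      coeffAlong (k := k) S B (monomial d₁ (coeff d₁ D) * monomial d₂ (coeff d₂ Φ)) =
        if d₁ = B then monomial d₂ (coeff d₁ D * coeff d₂ Φ) else 0 := by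
    intro d₁ hd₁ d₂ hd₂
    rw [monomial_mul, coeffAlong_monomial]
    have h1 : sPart S (d₁ + d₂) = d₁ := by
      have := sPart_add_uPart S d₁
      rw [hD d₁ hd₁, add_zero] at this
      simp only [sPart, Finsupp.filter_add] at this ⊢
      rw [this]; simpa [sPart] using hΦ d₂ hd₂
    have h2 : uPart S (d₁ + d₂) = d₂ := by
      have := sPart_add_uPart S d₂
      rw [hΦ d₂ hd₂, zero_add] at this
      simp only [uPart, Finsupp.filter_add] at this ⊢
      rw [this]
      have h0 := hD d₁ hd₁
      simp only [uPart] at h0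
      rw [h0, zero_add]
    rw [h1, h2]
  rw [Finset.sum_congr rfl fun d₁ hd₁ => Finset.sum_congr rfl fun d₂ hd₂ => key d₁ hd₁ d₂ hd₂,
    Finset.sum_comm]
  simp_rw [Finset.sum_ite_eq' D.support]
  by_cases hB : B ∈ D.support
  · simp_rw [if_pos hB]
    conv_rhs => rw [Φ.as_sum, Finset.smul_sum]
    refine Finset.sum_congr rfl fun d₂ _ => ?_
    rw [smul_monomial, smul_eq_mul]
  · simp_rw [if_neg hB]
    rw [Finset.sum_const_zero, notMem_support_iff.mp hB, zero_smul]

end CoeffAlong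

/-! ### Step 2 infrastructure: top and next-to-top slices of `∏ (A_i + B_i)^{e_i}` -/

section TopNext

variable (w : Fin n → ℕ)

/-- `Bdd w c E R`: every monomial of `R` has `w`-weight at most `E − c` (bookkeeping of Taylor
remainders). [folklore] -/
private def Bdd (c E : ℕ) (R : MvPolynomial (Fin n) k) : Prop :=
  ∀ d ∈ R.support, weight w d + c ≤ E

variable {w}

/-- `0` is bounded. [folklore] -/
private theorem bdd_zero (c E : ℕ) : Bdd (k := k) w c E 0 := fun d hd => by simp at hd

/-- Weakening the bound. [folklore] -/
private theorem Bdd.mono {c c' E : ℕ} {R : MvPolynomial (Fin n) k} (h : Bdd w c E R) (hc : c' ≤ c) :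
    Bdd w c' E R := fun d hd => le_trans (Nat.add_le_add_left hc _) (h d hd)

/-- Sums of bounded polynomials. [folklore] -/
private theorem Bdd.add {c E : ℕ} {Q R : MvPolynomial (Fin n) k} (hQ : Bdd w c E Q) (hR : Bdd w c E R) :
    Bdd w c E (Q + R) := fun d hd => by
  classical
  rcases Finset.mem_union.mp (support_add hd) with h | h
  · exact hQ d h
  · exact hR d h

/-- Finite sums of bounded polynomials. [folklore] -/
private theorem Bdd.sum {ι : Type*} {c E : ℕ} (s : Finset ι) {Q : ι → MvPolynomial (Fin n) k}
    (h : ∀ i ∈ s, Bdd w c E (Q i)) : Bdd w c E (∑ i ∈ s, Q i) := by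
  classical
  induction s using Finset.induction_on with
  | empty => rw [Finset.sum_empty]; exact bdd_zero c E
  | insert a s ha ih =>
    rw [Finset.sum_insert ha]
    exact (h a (Finset.mem_insert_self _ _)).add (ih fun i hi => h i (Finset.mem_insert_of_mem hi))

/-- Products of bounded polynomials (bounds add). [folklore] -/
private theorem Bdd.mul {c₁ c₂ E₁ E₂ : ℕ} {Q R : MvPolynomial (Fin n) k} (hQ : Bdd w c₁ E₁ Q)
    (hR : Bdd w c₂ E₂ R) : Bdd w (c₁ + c₂) (E₁ + E₂) (Q * R) := fun d hd => by
  classical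
  obtain ⟨a, ha, b, hb, rfl⟩ := Finset.mem_add.mp (support_mul Q R hd)
  have h1 := hQ a ha
  have h2 := hR b hb
  rw [map_add]
  omega

/-- Natural multiples of a bounded polynomial. [folklore] -/
private theorem Bdd.nsmul {c E : ℕ} {Q : MvPolynomial (Fin n) k} (hQ : Bdd w c E Q) (m : ℕ) :
    Bdd w c E (m • Q) := fun d hd => hQ d (support_smul hd)

/-- A weighted-homogeneous polynomial of weight `t ≤ E − c` is bounded. [folklore] -/
private theorem Bdd.of_isWeightedHomogeneous {t c E : ℕ} {T : MvPolynomial (Fin n) k}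
    (hT : IsWeightedHomogeneous w T t) (h : t + c ≤ E) : Bdd w c E T := fun d hd => by
  rw [hT (mem_support_iff.mp hd)]; exact h

/-- Powers of a bounded polynomial. [folklore] -/
private theorem Bdd.pow {E : ℕ} {Q : MvPolynomial (Fin n) k} (hQ : Bdd w 0 E Q) (m : ℕ) :
    Bdd w 0 (m * E) (Q ^ m) := by
  induction m with
  | zero =>
    rw [pow_zero, Nat.zero_mul]
    exact Bdd.of_isWeightedHomogeneous (isWeightedHomogeneous_one k w) le_rfl
  | succ m ih =>
    rw [pow_succ, Nat.succ_mul]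
    exact ih.mul hQ

/-- A polynomial of weight `≤ E − c` has no weighted component of weight `m > E − c`. [folklore] -/
private theorem Bdd.weightedHomogeneousComponent_eq_zero {c E m : ℕ} {R : MvPolynomial (Fin n) k}
    (hR : Bdd w c E R) (hm : E < m + c) : weightedHomogeneousComponent w m R = 0 := by
  apply weightedHomogeneousComponent_eq_zero'
  intro d hd h
  have := hR d hd; rw [h] at this; omega

/-- First-order binomial expansion with graded remainder: for `A` of weight `1` and `B` of weight
`0`, `(A + B)^e = A^e + e·B·A^{e−1} + R` with `R` of weight `≤ e − 2`. [folklore] -/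
private theorem add_pow_decomp {A B : MvPolynomial (Fin n) k} (hA : IsWeightedHomogeneous w A 1)
    (hB : IsWeightedHomogeneous w B 0) (e : ℕ) :
    ∃ R, Bdd w 2 e R ∧ (A + B) ^ e = A ^ e + e • (B * A ^ (e - 1)) + R := by
  rcases Nat.eq_zero_or_pos e with rfl | he
  · exact ⟨0, bdd_zero 2 0, by simp⟩
  obtain ⟨m, rfl⟩ := Nat.exists_eq_add_one_of_ne_zero he.ne'
  refine ⟨∑ j ∈ Finset.range m,
    A ^ j * B ^ (m + 1 - j) * (((m + 1).choose j : ℕ) : MvPolynomial (Fin n) k), ?_, ?_⟩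
  · refine Bdd.sum _ fun j hj => ?_
    have hj := Finset.mem_range.mp hj
    have h1 : IsWeightedHomogeneous w
        (A ^ j * B ^ (m + 1 - j) * (((m + 1).choose j : ℕ) : MvPolynomial (Fin n) k))
        (j • 1 + (m + 1 - j) • 0 + 0) := by
      refine ((hA.pow j).mul (hB.pow _)).mul ?_
      rw [← map_natCast C]
      exact isWeightedHomogeneous_C w _
    simp only [smul_eq_mul, mul_one, mul_zero, add_zero] at h1
    exact Bdd.of_isWeightedHomogeneous h1 (by omega)
  · rw [add_pow, Finset.sum_range_succ, Finset.sum_range_succ, Nat.choose_self,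
      Nat.choose_succ_self_right, Nat.add_sub_cancel, show m + 1 - m = 1 by omega, pow_one,
      Nat.sub_self, pow_zero, mul_one, Nat.cast_one, mul_one]
    have : A ^ m * B * ((m + 1 : ℕ) : MvPolynomial (Fin n) k) = (m + 1) • (B * A ^ m) := by
      rw [nsmul_eq_mul]; push_cast; ring
    rw [this]; ring

/-- First-order Taylor expansion of `Π_i (A_i + B_i)^{e_i}` in the weight-`0` perturbations `B_i`
(`A_i` of weight `1`), with a remainder of weight `≤ Σ e − 2`. [folklore] -/
private theorem prod_add_pow_decomp (A B : Fin n → MvPolynomial (Fin n) k) (e : Fin n → ℕ)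
    (s : Finset (Fin n)) (hA : ∀ i ∈ s, IsWeightedHomogeneous w (A i) 1)
    (hB : ∀ i ∈ s, IsWeightedHomogeneous w (B i) 0) :
    ∃ R, Bdd w 2 (∑ i ∈ s, e i) R ∧
      ∏ i ∈ s, (A i + B i) ^ e i = ∏ i ∈ s, A i ^ e i
        + ∑ i ∈ s, e i • (B i * A i ^ (e i - 1) * ∏ j ∈ s.erase i, A j ^ e j) + R := by
  classical
  induction s using Finset.induction_on with
  | empty => exact ⟨0, bdd_zero _ _, by simp⟩
  | insert a s ha ih =>
    obtain ⟨Rs, hRs, hPs⟩ := ih (fun i hi => hA i (Finset.mem_insert_of_mem hi))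
      (fun i hi => hB i (Finset.mem_insert_of_mem hi))
    obtain ⟨Ra, hRa, hPa⟩ := add_pow_decomp (hA a (Finset.mem_insert_self _ _))
      (hB a (Finset.mem_insert_self _ _)) (e a)
    -- names
    set Ta := A a ^ e a with hTa
    set Na := e a • (B a * A a ^ (e a - 1)) with hNa
    set Ts := ∏ i ∈ s, A i ^ e i with hTs
    set Ns := ∑ i ∈ s, e i • (B i * A i ^ (e i - 1) * ∏ j ∈ s.erase i, A j ^ e j) with hNs
    set Es := ∑ i ∈ s, e i with hEs
    -- weight bookkeeping
    have hTa' : IsWeightedHomogeneous w Ta (e a) := by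
      simpa using (hA a (Finset.mem_insert_self _ _)).pow (e a)
    have hTs' : IsWeightedHomogeneous w Ts Es := by
      have := IsWeightedHomogeneous.prod s (fun i => A i ^ e i) (fun i => e i • 1)
        (fun i hi => (hA i (Finset.mem_insert_of_mem hi)).pow (e i))
      simpa using this
    have hNa' : Bdd w 1 (e a) Na := by
      rcases Nat.eq_zero_or_pos (e a) with h0 | hpos
      · rw [hNa, h0, zero_smul]; exact bdd_zero _ _
      · refine Bdd.nsmul (Bdd.of_isWeightedHomogeneous (t := 0 + (e a - 1) • 1) ?_ (by simp; omega)) _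
        exact (hB a (Finset.mem_insert_self _ _)).mul ((hA a (Finset.mem_insert_self _ _)).pow _)
    have hNs' : Bdd w 1 Es Ns := by
      refine Bdd.sum _ fun i hi => ?_
      rcases Nat.eq_zero_or_pos (e i) with h0 | hpos
      · rw [h0, zero_smul]; exact bdd_zero _ _
      · refine Bdd.nsmul (Bdd.of_isWeightedHomogeneous
          (t := 0 + (e i - 1) • 1 + ∑ j ∈ s.erase i, e j • 1) ?_ ?_) _
        · exact ((hB i (Finset.mem_insert_of_mem hi)).mul
            ((hA i (Finset.mem_insert_of_mem hi)).pow _)).mul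
            (IsWeightedHomogeneous.prod (s.erase i) (fun j => A j ^ e j) (fun j => e j • 1)
              fun j hj => (hA j (Finset.mem_insert_of_mem (Finset.mem_of_mem_erase hj))).pow _)
        · simp only [smul_eq_mul, mul_one, zero_add]
          have := Finset.sum_erase_add s e hi
          omega
    have hRs' : Bdd w 2 Es Rs := hRs
    have hTaB : Bdd w 0 (e a) Ta := Bdd.of_isWeightedHomogeneous hTa' le_rfl
    have hTsB : Bdd w 0 Es Ts := Bdd.of_isWeightedHomogeneous hTs' le_rfl
    refine ⟨Ta * Rs + Na * Ns + Na * Rs + Ra * Ts + Ra * Ns + Ra * Rs, ?_, ?_⟩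
    · rw [Finset.sum_insert ha]
      refine ((((Bdd.add ?_ ?_).add ?_).add ?_).add ?_).add ?_
      · exact hTaB.mul hRs'
      · exact hNa'.mul hNs'
      · exact (hNa'.mul hRs').mono (by norm_num)
      · exact hRa.mul hTsB
      · exact (hRa.mul hNs').mono (by norm_num)
      · exact (hRa.mul hRs').mono (by norm_num)
    · rw [Finset.prod_insert ha, Finset.prod_insert ha, hPa, hPs, Finset.sum_insert ha,
        Finset.erase_insert ha]
      have hmid : ∑ i ∈ s, e i • (B i * A i ^ (e i - 1) * ∏ j ∈ (insert a s).erase i, A j ^ e j)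
          = Ta * Ns := by
        rw [hNs, Finset.mul_sum]
        refine Finset.sum_congr rfl fun i hi => ?_
        rw [Finset.erase_insert_of_ne (by rintro rfl; exact ha hi),
          Finset.prod_insert (fun h => ha (Finset.mem_of_mem_erase h)), mul_smul_comm, ← hTa]
        congr 1; ring
      rw [hmid, ← hTs, ← hTa, show e a • (B a * A a ^ (e a - 1) * Ts) = Na * Ts by
        rw [hNa, smul_mul_assoc]]
      ring

/-- Natural multiples of weighted-homogeneous polynomials. [folklore] -/
private theorem isWeightedHomogeneous_nsmul {t : ℕ} {Q : MvPolynomial (Fin n) k}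
    (hQ : IsWeightedHomogeneous w Q t) (m : ℕ) : IsWeightedHomogeneous w (m • Q) t := by
  rw [nsmul_eq_mul, ← map_natCast C, ← zero_add t]
  exact (isWeightedHomogeneous_C w _).mul hQ

/-- The first-order Taylor term of `Π_i (A_i + B_i)^{e_i}` is homogeneous of weight `Σ e − 1`. [folklore] -/
private theorem isWeightedHomogeneous_next (A B : Fin n → MvPolynomial (Fin n) k) (e : Fin n → ℕ)
    (s : Finset (Fin n)) (hA : ∀ i ∈ s, IsWeightedHomogeneous w (A i) 1)
    (hB : ∀ i ∈ s, IsWeightedHomogeneous w (B i) 0) {m : ℕ} (hm : m + 1 = ∑ i ∈ s, e i) :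
    IsWeightedHomogeneous w
      (∑ i ∈ s, e i • (B i * A i ^ (e i - 1) * ∏ j ∈ s.erase i, A j ^ e j)) m := by
  classical
  refine IsWeightedHomogeneous.sum _ _ _ fun i hi => ?_
  rcases Nat.eq_zero_or_pos (e i) with h0 | hpos
  · rw [h0, zero_smul]; exact isWeightedHomogeneous_zero k w m
  · have h := ((hB i hi).mul ((hA i hi).pow (e i - 1))).mul
      (IsWeightedHomogeneous.prod (s.erase i) (fun j => A j ^ e j) (fun j => e j • 1)
        fun j hj => (hA j (Finset.mem_of_mem_erase hj)).pow _)
    have ht : 0 + (e i - 1) • 1 + ∑ j ∈ s.erase i, e j • 1 = m := by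
      simp only [smul_eq_mul, mul_one, zero_add]
      have := Finset.sum_erase_add s e hi
      omega
    rw [ht] at h
    exact isWeightedHomogeneous_nsmul h _

/-- Top weight component of `Π_i (A_i + B_i)^{e_i}` (`A_i` of weight `1`, `B_i` of weight `0`):
`Π_i A_i^{e_i}`. [folklore] -/
private theorem weightedHomogeneousComponent_prod_top (A B : Fin n → MvPolynomial (Fin n) k)
    (e : Fin n → ℕ) (s : Finset (Fin n)) (hA : ∀ i ∈ s, IsWeightedHomogeneous w (A i) 1)
    (hB : ∀ i ∈ s, IsWeightedHomogeneous w (B i) 0) :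
    weightedHomogeneousComponent w (∑ i ∈ s, e i) (∏ i ∈ s, (A i + B i) ^ e i)
      = ∏ i ∈ s, A i ^ e i := by
  classical
  obtain ⟨R, hR, hP⟩ := prod_add_pow_decomp A B e s hA hB
  have hT : IsWeightedHomogeneous w (∏ i ∈ s, A i ^ e i) (∑ i ∈ s, e i) := by
    have := IsWeightedHomogeneous.prod s (fun i => A i ^ e i) (fun i => e i • 1)
      (fun i hi => (hA i hi).pow (e i))
    simpa using this
  rw [hP, map_add, map_add, hT.weightedHomogeneousComponent_same,
    hR.weightedHomogeneousComponent_eq_zero (by omega), add_zero]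
  rcases Nat.eq_zero_or_pos (∑ i ∈ s, e i) with h0 | hpos
  · -- all exponents vanish: the next slice is literally zero
    have : ∑ i ∈ s, e i • (B i * A i ^ (e i - 1) * ∏ j ∈ s.erase i, A j ^ e j) = 0 := by
      refine Finset.sum_eq_zero fun i hi => ?_
      have : e i = 0 := by
        have := Finset.sum_eq_zero_iff.mp h0 i hi; exact this
      rw [this, zero_smul]
    rw [this, map_zero, add_zero]
  · obtain ⟨m, hm⟩ := Nat.exists_eq_add_one_of_ne_zero hpos.ne'
    rw [(isWeightedHomogeneous_next A B e s hA hB hm.symm).weightedHomogeneousComponent_ne _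
      (by omega), add_zero]

/-- Next-to-top weight component of `Π_i (A_i + B_i)^{e_i}`: the first-order Taylor term
`Σ_i e_i · B_i A_i^{e_i − 1} Π_{j ≠ i} A_j^{e_j}`. [folklore] -/
private theorem weightedHomogeneousComponent_prod_next (A B : Fin n → MvPolynomial (Fin n) k)
    (e : Fin n → ℕ) (s : Finset (Fin n)) (hA : ∀ i ∈ s, IsWeightedHomogeneous w (A i) 1)
    (hB : ∀ i ∈ s, IsWeightedHomogeneous w (B i) 0) {m : ℕ} (hm : m + 1 = ∑ i ∈ s, e i) :
    weightedHomogeneousComponent w m (∏ i ∈ s, (A i + B i) ^ e i)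
      = ∑ i ∈ s, e i • (B i * A i ^ (e i - 1) * ∏ j ∈ s.erase i, A j ^ e j) := by
  classical
  obtain ⟨R, hR, hP⟩ := prod_add_pow_decomp A B e s hA hB
  have hT : IsWeightedHomogeneous w (∏ i ∈ s, A i ^ e i) (∑ i ∈ s, e i) := by
    have := IsWeightedHomogeneous.prod s (fun i => A i ^ e i) (fun i => e i • 1)
      (fun i hi => (hA i hi).pow (e i))
    simpa using this
  rw [hP, map_add, map_add, hT.weightedHomogeneousComponent_ne _ (by omega),
    (isWeightedHomogeneous_next A B e s hA hB hm).weightedHomogeneousComponent_same,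
    hR.weightedHomogeneousComponent_eq_zero (by omega), zero_add, add_zero]

/-- `Π_i (A_i + B_i)^{e_i}` has no component above the top weight `Σ e`. [folklore] -/
private theorem weightedHomogeneousComponent_prod_eq_zero_of_lt (A B : Fin n → MvPolynomial (Fin n) k)
    (e : Fin n → ℕ) (s : Finset (Fin n)) (hA : ∀ i ∈ s, IsWeightedHomogeneous w (A i) 1)
    (hB : ∀ i ∈ s, IsWeightedHomogeneous w (B i) 0) {m : ℕ} (hm : ∑ i ∈ s, e i < m) :
    weightedHomogeneousComponent w m (∏ i ∈ s, (A i + B i) ^ e i) = 0 := by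
  classical
  have : Bdd w 0 (∑ i ∈ s, e i * 1) (∏ i ∈ s, (A i + B i) ^ e i) := by
    induction s using Finset.induction_on with
    | empty =>
      simp only [Finset.prod_empty, Finset.sum_empty]
      exact Bdd.of_isWeightedHomogeneous (isWeightedHomogeneous_one k w) le_rfl
    | insert a t ha ih =>
      rw [Finset.prod_insert ha, Finset.sum_insert ha]
      exact (Bdd.pow ((Bdd.of_isWeightedHomogeneous (hA a (Finset.mem_insert_self _ _)) le_rfl).add
        (Bdd.of_isWeightedHomogeneous (hB a (Finset.mem_insert_self _ _)) zero_le_one)) _).mul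
        (ih (fun i hi => hA i (Finset.mem_insert_of_mem hi))
          (fun i hi => hB i (Finset.mem_insert_of_mem hi))
          (lt_of_le_of_lt (Finset.sum_le_sum_of_subset_of_nonneg (Finset.subset_insert a t)
            (fun _ _ _ => Nat.zero_le _)) hm))
  simp only [mul_one] at this
  exact this.weightedHomogeneousComponent_eq_zero (by omega)

end TopNext

/-! ### Step 4/5 infrastructure: chain rule for `pderiv ∘ aeval`, dual functionals -/

section Chain

/-- Chain rule for `pderiv` through `aeval`: `∂_l (H(L)) = Σ_i (∂_i H)(L) · ∂_l L_i`. [folklore] -/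
private theorem pderiv_aeval_eq_sum (L : Fin n → MvPolynomial (Fin n) k) (H : MvPolynomial (Fin n) k)
    (l : Fin n) :
    pderiv l (aeval L H) = ∑ i, aeval L (pderiv i H) * pderiv l (L i) := by
  classical
  induction H using MvPolynomial.induction_on with
  | C a => simp
  | add p q hp hq => simp only [map_add, hp, hq, add_mul, Finset.sum_add_distrib]
  | mul_X p i hp =>
    have key : ∀ x, aeval L (pderiv x (p * X i)) * pderiv l (L x) =
        L i * (aeval L (pderiv x p) * pderiv l (L x)) +
          (if i = x then aeval L p * pderiv l (L x) else 0) := by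
      intro x
      rw [Derivation.leibniz, smul_eq_mul, smul_eq_mul, pderiv_X, Pi.single_apply, map_add,
        map_mul, map_mul, aeval_X]
      split_ifs with h1
      · simp; ring
      · simp; ring
    rw [Finset.sum_congr rfl fun x _ => key x, Finset.sum_add_distrib, Finset.sum_ite_eq,
      if_pos (Finset.mem_univ _), ← Finset.mul_sum, ← hp, map_mul, aeval_X, Derivation.leibniz,
      smul_eq_mul, smul_eq_mul]
    ring

/-- Dual functionals to a linearly independent finite family over a field. [folklore] -/
private theorem exists_dual_eq_ite {ι V : Type*} [Fintype ι] [DecidableEq ι] [AddCommGroup V] [Module k V]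
    {D : ι → V} (hD : LinearIndependent k D) (i₁ : ι) :
    ∃ g : V →ₗ[k] k, ∀ i, g (D i) = if i = i₁ then 1 else 0 := by
  obtain ⟨g, hg⟩ := LinearMap.exists_extend ((Finsupp.lapply i₁).comp hD.repr)
  refine ⟨g, fun i => ?_⟩
  have hmem : D i ∈ Submodule.span k (Set.range D) := Submodule.subset_span ⟨i, rfl⟩
  have := LinearMap.congr_fun hg ⟨D i, hmem⟩
  simp only [LinearMap.coe_comp, Submodule.coe_subtype, Function.comp_apply] at this
  rw [this, hD.repr_eq_single i ⟨D i, hmem⟩ rfl, Finsupp.lapply_apply, Finsupp.single_apply]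

/-- A finite family whose span contains a linearly independent family indexed by the same finite
type is itself linearly independent (dimension count). [folklore] -/
private theorem linearIndependent_of_span_le {ι V : Type*} [Fintype ι] [AddCommGroup V] [Module k V]
    {D F : ι → V} (hF : LinearIndependent k F)
    (hle : ∀ l, F l ∈ Submodule.span k (Set.range D)) : LinearIndependent k D := by
  rw [linearIndependent_iff_card_eq_finrank_span]
  refine le_antisymm ?_ (finrank_range_le_card D)
  have h1 : Submodule.span k (Set.range F) ≤ Submodule.span k (Set.range D) :=
    Submodule.span_le.mpr (by rintro _ ⟨l, rfl⟩; exact hle l)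
  haveI : Module.Finite k (Submodule.span k (Set.range D)) :=
    FiniteDimensional.span_of_finite k (Set.finite_range D)
  calc Fintype.card ι = Module.finrank k (Submodule.span k (Set.range F)) :=
        (finrank_span_eq_card hF).symm
    _ ≤ Module.finrank k (Submodule.span k (Set.range D)) := Submodule.finrank_mono h1

/-- A functional dual to a family `D` that VANISHES on a given subspace `W`: it exists as soon as an
independent family `F` with `span F ∩ W = 0` lies in the span of `D` (then `D` is independent modulo
`W`, by the dimension count of `linearIndependent_of_span_le` in the quotient `V ⧸ W`). [folklore] -/
private theorem exists_dual_eq_ite_of_disjoint {ι V : Type*} [Fintype ι] [DecidableEq ι]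
    [AddCommGroup V] [Module k V] {D F : ι → V} (W : Submodule k V)
    (hF : LinearIndependent k F) (hdisj : Disjoint (Submodule.span k (Set.range F)) W)
    (hle : ∀ l, F l ∈ Submodule.span k (Set.range D)) (i₁ : ι) :
    ∃ g : V →ₗ[k] k, (∀ i, g (D i) = if i = i₁ then 1 else 0) ∧ ∀ x ∈ W, g x = 0 := by
  have hFq : LinearIndependent k (W.mkQ ∘ F) :=
    hF.map (by rw [Submodule.ker_mkQ]; exact hdisj)
  have hDq : LinearIndependent k (W.mkQ ∘ D) := by
    refine linearIndependent_of_span_le hFq fun l => ?_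
    have := Submodule.apply_mem_span_image_of_mem_span W.mkQ (hle l)
    rwa [← Set.range_comp] at this
  obtain ⟨g, hg⟩ := exists_dual_eq_ite hDq i₁
  refine ⟨g ∘ₗ W.mkQ, fun i => ?_, fun x hx => ?_⟩
  · have := hg i
    simp only [Function.comp_apply] at this
    rw [LinearMap.comp_apply]
    exact this
  · rw [LinearMap.comp_apply, Submodule.mkQ_apply, (Submodule.Quotient.mk_eq_zero W).mpr hx, map_zero]

end Chain

/-! ## 2. The normalised face: the slices `N_e` and the count under (N0_W) -/

section NormalisedFace

variable {f : MvPolynomial (Fin n) k} {ν : ℕ} {S : Finset (Fin n)}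

/-- An exponent of `y`-degree `0` has zero `S`-part. [folklore] -/
private theorem sPart_eq_zero_of_blockDeg_eq_zero {d : Fin n →₀ ℕ} (h : blockDeg S d = 0) :
    sPart S d = 0 := by
  classical
  rw [blockDeg_eq_sum_univ, Finset.sum_eq_zero_iff] at h
  ext i
  by_cases hi : i ∈ S
  · have := h i hi
    simp [sPart, hi, this]
  · simp [sPart, hi]

/-- An exponent of `u`-degree `0` has zero `u`-part. [folklore] -/
private theorem uPart_eq_zero_of_coDeg_eq_zero {d : Fin n →₀ ℕ} (h : coDeg S d = 0) :
    uPart S d = 0 := by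
  classical
  rw [coDeg_eq_sum_univ, Finset.sum_eq_zero_iff] at h
  ext i
  by_cases hi : i ∈ S
  · simp [uPart, hi]
  · have := h i (Finset.mem_filter.mpr ⟨Finset.mem_univ _, hi⟩)
    simp [uPart, hi, this]

/-- A polynomial of `X_S`-degree `0` lies in `k[X_{Sᶜ}]` (exponentwise). [folklore] -/
private theorem sPart_eq_zero_of_isWeightedHomogeneous {P : MvPolynomial (Fin n) k}
    (hP : IsWeightedHomogeneous (fun i => if i ∈ S then 1 else 0) P 0) :
    ∀ d ∈ P.support, sPart S d = 0 := fun d hd => by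
  apply sPart_eq_zero_of_blockDeg_eq_zero
  have := hP (mem_support_iff.mp hd)
  rw [weight_block] at this
  omega

/-- A polynomial of `X_{Sᶜ}`-degree `0` lies in `k[X_S]` (exponentwise). [folklore] -/
private theorem uPart_eq_zero_of_isWeightedHomogeneous {P : MvPolynomial (Fin n) k}
    (hP : IsWeightedHomogeneous (fun i => if i ∈ S then 0 else 1) P 0) :
    ∀ d ∈ P.support, uPart S d = 0 := fun d hd => by
  apply uPart_eq_zero_of_coDeg_eq_zero
  have := hP (mem_support_iff.mp hd)
  rw [weight_block] at this
  omega

/-- Evaluating an `S`-supported monomial: `(c X^d)(L) = c Π_{i ∈ S} L_i^{d_i}`. [folklore] -/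
private theorem aeval_monomial_of_supported (Lin : Fin n → MvPolynomial (Fin n) k) {d : Fin n →₀ ℕ}
    (hd : ∀ j ∉ S, d j = 0) (c : k) :
    aeval Lin (monomial d c) = C c * ∏ i ∈ S, Lin i ^ d i := by
  classical
  rw [aeval_monomial, algebraMap_eq, Finsupp.prod_fintype _ _ (fun i => by rw [pow_zero])]
  congr 1
  rw [← Finset.prod_filter_mul_prod_filter_not Finset.univ (· ∈ S)]
  have h1 : Finset.univ.filter (· ∈ S) = S := by ext i; simp
  rw [h1, Finset.prod_eq_one (s := Finset.univ.filter (· ∉ S)) fun j hj => by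
    rw [hd j (Finset.mem_filter.mp hj).2, pow_zero], mul_one]

/-- One first-order Taylor term: `c · d_i Φ_i L^{d − e_i} = Φ_i · (∂_i (c X^d))(L)`. [folklore] -/
private theorem taylor_term_eq (Lin Φ : Fin n → MvPolynomial (Fin n) k) {d : Fin n →₀ ℕ}
    (hd : ∀ j ∉ S, d j = 0) (c : k) {i : Fin n} (hi : i ∈ S) :
    C c * (d i • (Φ i * Lin i ^ (d i - 1) * ∏ j ∈ S.erase i, Lin j ^ d j))
      = Φ i * aeval Lin (pderiv i (monomial d c)) := by
  classical
  have hd' : ∀ j ∉ S, (d - Finsupp.single i 1 : Fin n →₀ ℕ) j = 0 := fun j hj => by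
    rw [Finsupp.tsub_apply, hd j hj, Nat.zero_sub]
  rw [pderiv_monomial, aeval_monomial_of_supported Lin hd', ← Finset.mul_prod_erase S _ hi]
  have hP : ∏ j ∈ S.erase i, Lin j ^ (d - Finsupp.single i 1 : Fin n →₀ ℕ) j =
      ∏ j ∈ S.erase i, Lin j ^ d j :=
    Finset.prod_congr rfl fun j hj => by
      rw [Finsupp.tsub_apply, Finsupp.single_eq_of_ne (Finset.ne_of_mem_erase hj), Nat.sub_zero]
  rw [hP, Finsupp.tsub_apply, Finsupp.single_eq_same, map_mul, map_natCast, nsmul_eq_mul]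
  ring

/-- The first-order Taylor terms, summed: `Σ_d c_d N_d = Σ_{i ∈ S} Φ_i · (∂_i H)(L)`. [folklore] -/
private theorem sum_taylor_terms_eq (Lin Φ : Fin n → MvPolynomial (Fin n) k) (T : Finset (Fin n →₀ ℕ))
    (c : (Fin n →₀ ℕ) → k) (hT : ∀ d ∈ T, ∀ j ∉ S, d j = 0) :
    ∑ d ∈ T, C (c d) * ∑ i ∈ S, d i • (Φ i * Lin i ^ (d i - 1) * ∏ j ∈ S.erase i, Lin j ^ d j)
      = ∑ i ∈ S, Φ i * aeval Lin (pderiv i (∑ d ∈ T, monomial d (c d))) := by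
  classical
  have h1 : ∀ i ∈ S, Φ i * aeval Lin (pderiv i (∑ d ∈ T, monomial d (c d))) =
      ∑ d ∈ T, Φ i * aeval Lin (pderiv i (monomial d (c d))) := fun i _ => by
    rw [map_sum, map_sum, Finset.mul_sum]
  rw [Finset.sum_congr rfl h1, Finset.sum_comm]
  refine Finset.sum_congr rfl fun d hd => ?_
  rw [Finset.mul_sum]
  exact Finset.sum_congr rfl fun i hi => taylor_term_eq Lin Φ (hT d hd) (c d) hi

/-- The `X_S`-degree-`(ν−1)` slice of `in_δ(f)`: the part `N = Σ_{|B| = ν−1, |A| = δ} c_{A,B} y^B u^A` of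
the `δ`-face of `y`-degree `ν − 1` (zero under (N0)). (Ours, elementary.)
[cite: CossartJannsenSaito2020, Def. 8.2 (4) (p. 118)] -/
theorem weightedHomogeneousComponent_indicator_deltaInitial_eq_sum {m : ℕ} {δ : ℚ} :
    weightedHomogeneousComponent (fun i => if i ∈ S then 1 else 0) m
      (deltaInitial S (m + 1) δ f) =
      ∑ d ∈ f.support with (blockDeg S d + 1 = m + 1 ∧ (coDeg S d : ℚ) = δ),
        monomial d (coeff d f) := by
  classical
  ext d
  rw [coeff_weightedHomogeneousComponent, weight_block, one_mul, zero_mul, add_zero,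
    coeff_sum_filter_monomial, deltaInitial, coeff_sum_filter_monomial]
  by_cases h1 : blockDeg S d = m
  · have hsub : ((m + 1 - blockDeg S d : ℕ) : ℚ) = 1 := by
      rw [h1, show m + 1 - m = 1 by omega, Nat.cast_one]
    rw [if_pos h1]
    by_cases hc : (coDeg S d : ℚ) = δ
    · rw [if_pos ⟨by omega, by rw [hsub, mul_one, hc]⟩, if_pos ⟨by omega, hc⟩]
    · rw [if_neg fun h => hc (by have h2 := h.2; rw [hsub, mul_one] at h2; exact h2),
        if_neg fun h => hc h.2]
  · rw [if_neg h1, if_neg fun h => h1 (by omega)]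

/-- **The slices `N_e` of the `δ`-face below the top `y`-degree.** For `e` a `u`-exponent,
`predFaceSlice S ν δ f e = N_e := Σ_{|B| = ν − 1, A = e, |A| = δ} c_{A,B} Y^B ∈ k[X_S]_{ν−1}`: the
`U^e`-coefficient of the `y`-degree-`(ν−1)` part `N = Σ_e N_e U^e` of the `δ`-face of `f`.  A
`y`-translation `Y ↦ Y + λ(U)`, `λ_l = c_l U^{A_l}` (the solutions of [CJS20 Thm. 8.22 (a)], i.e. the
moves of Hironaka's preparation / Tschirnhaus normalisation; more generally `λ_l ∈ k[U]_δ`) adds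
`Σ_l λ_{l,e} · ∂_l in_ν(f)` to `N_e` (`λ_{l,e}` the `U^e`-coefficient of `λ_l`), so the classes of the
`N_e` modulo `span_k {∂_l in_ν f}` are unchanged by them and `N = 0` (N0) is reachable by such
`λ ∈ k[U]_δ^S` iff every `N_e` lies in that span; hypothesis (N0_W) of
`uHomogeneousPart_mem_linearFormsSubalgebra_of_disjoint` is the transversal case: the `N_e` span a
space meeting `span_k {∂_l in_ν f}` only in `0` (it contains (N0)).
[cite: CossartJannsenSaito2020, Def. 8.2 (4) (p. 118), Def. 8.13 (pp. 120–121), Thm. 8.22 (a) (p. 124)] -/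
def predFaceSlice (S : Finset (Fin n)) (ν : ℕ) (δ : ℚ) (f : MvPolynomial (Fin n) k)
    (e : Fin n →₀ ℕ) : MvPolynomial (Fin n) k :=
  ∑ d ∈ f.support with ((blockDeg S d + 1 = ν ∧ (coDeg S d : ℚ) = δ) ∧ coPart S d = e),
    monomial (d.filter fun i => i ∈ S) (coeff d f)

/-- `(d|_S)|_{Sᶜ} = 0`. [folklore] -/
private theorem uPart_sPart (d : Fin n →₀ ℕ) : uPart S (sPart S d) = 0 := by
  classical
  ext i
  by_cases hi : i ∈ S <;> simp [uPart, sPart, hi]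

/-- `(d|_{Sᶜ})|_S = 0`. [folklore] -/
private theorem sPart_uPart (d : Fin n →₀ ℕ) : sPart S (uPart S d) = 0 := by
  classical
  ext i
  by_cases hi : i ∈ S <;> simp [uPart, sPart, hi]

/-- `N_e ∈ k[X_S]` (exponentwise). [folklore] -/
private theorem uPart_eq_zero_of_mem_support_predFaceSlice {δ : ℚ} {e d : Fin n →₀ ℕ}
    (hd : d ∈ (predFaceSlice S ν δ f e).support) : uPart S d = 0 := by
  classical
  rw [predFaceSlice] at hd
  obtain ⟨d', -, hd'⟩ := Finset.mem_biUnion.mp (support_sum hd)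
  rw [Finset.mem_singleton.mp (support_monomial_subset hd')]
  exact uPart_sPart d'

/-- The exponents of `N_e` are `S`-parts of exponents of the slice. [folklore] -/
private theorem support_predFaceSlice_subset {δ : ℚ} (e : Fin n →₀ ℕ) :
    (predFaceSlice S ν δ f e).support ⊆
      (f.support.filter fun d => blockDeg S d + 1 = ν ∧ (coDeg S d : ℚ) = δ).image (sPart S) := by
  classical
  intro d hd
  rw [predFaceSlice] at hd
  obtain ⟨d', hd'mem, hd'⟩ := Finset.mem_biUnion.mp (support_sum hd)
  rw [Finset.mem_singleton.mp (support_monomial_subset hd')]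
  obtain ⟨h1, h2, -⟩ := Finset.mem_filter.mp hd'mem
  exact Finset.mem_image_of_mem _ (Finset.mem_filter.mpr ⟨h1, h2⟩)

/-- `N = Σ_e N_e · U^e`. [folklore] -/
private theorem sum_filter_eq_sum_predFaceSlice {δ : ℚ} :
    ∑ d ∈ f.support with (blockDeg S d + 1 = ν ∧ (coDeg S d : ℚ) = δ), monomial d (coeff d f) =
      ∑ e ∈ (f.support.filter fun d => blockDeg S d + 1 = ν ∧ (coDeg S d : ℚ) = δ).image (uPart S),
        predFaceSlice S ν δ f e * monomial e 1 := by
  classical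
  set P := f.support.filter fun d => blockDeg S d + 1 = ν ∧ (coDeg S d : ℚ) = δ with hP
  rw [← Finset.sum_fiberwise_of_maps_to (s := P) (t := P.image (uPart S)) (g := uPart S)
    (fun d hd => Finset.mem_image_of_mem _ hd)]
  refine Finset.sum_congr rfl fun e _ => ?_
  have hfilter : (f.support.filter fun d =>
      (blockDeg S d + 1 = ν ∧ (coDeg S d : ℚ) = δ) ∧ coPart S d = e) =
      P.filter fun d => uPart S d = e := by
    ext d
    simp only [hP, Finset.mem_filter, and_assoc, uPart, coPart]
  rw [predFaceSlice, hfilter, Finset.sum_mul]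
  refine Finset.sum_congr rfl fun d hd => ?_
  rw [monomial_mul, mul_one]
  have := sPart_add_uPart S d
  rw [(Finset.mem_filter.mp hd).2] at this
  rw [show Finsupp.filter (fun i => i ∈ S) d + e = d from this]


/-- **The twists are polynomials in the competitor's forms (general `τ`, Hironaka-normalised face).**
Let `ν = ord f`, `in_ν f ∈ k[X_S]`, `|S| = τ(in_ν f)`, `(f; X_S; X_{Sᶜ})` `δ`-prepared with
`δ = δ(f;u;y)`; assume (IND) the partials `∂_l in_ν f`, `l ∈ S`, are linearly independent over `k`
and (N0_W) the slices `N_e ∈ k[X_S]_{ν−1}` of the `y`-degree-`(ν−1)` part `N = Σ_e N_e U^e` of the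
`δ`-face of `f` (`predFaceSlice`) span a space meeting `span_k {∂_l in_ν f : l ∈ S}` only in `0`
— e.g. `N = 0` (hypothesis (N0) of REV. 4, `disjoint_span_pderiv_predFaceSlice_of_forall_ne`).
Then for every centre `(Ψ; γ)` for `f` with `γ = 1/ν` on `S` and `γ ≤ 1/(νδ)` off `S`, every
pure-`u` degree-`δ` part `Φ_i` of `z_i = Ψ(X_i)` (`i ∈ S`) lies in `k[T(Ψ, γ)]`.
Proof: grade `in_δ(f) = H(Lin + Φ, ℓ(u))` (`deltaInitial_eq_aeval_of_isCentreFor`) by `X_S`-degree;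
the degree-`ν` slice is `in_ν f = H_ν(Lin)`, the degree-`(ν−1)` slice reads
`N = Σ_{i ∈ S} Φ_i · (∂_i H_ν)(Lin) + (polynomial over k[X_S] ⊗ k[T])`; by the chain rule the
`(∂_i H_ν)(Lin)` span the `∂_l in_ν f`, so they are independent MODULO `W₀ = span_k {N_e}`, and
coefficient extraction along `k[X_S]` against a functional dual to them and vanishing on `W₀` kills
`N` and isolates each `Φ_i` in `k[T(Ψ, γ)]`.  (Ours, in the model.  (N0_W) contains (N0) and is NOT
redundant: over `𝔽₂`, `ν = 3`, `φ = u₁² + u₁u₂ + u₂²`, `f = (y₁ + φ)³ + y₂³ + y₂(u₁ + u₂)²(y₁ + φ)` is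
`δ`-prepared with (IND), its slice `N_{u₁u₂} = y₁² = ∂_{y₁} in_ν f` violates (N0_W),
`τ(in_δ f) = 4`, and the centre `(y₁ ↦ y₁ + φ, u₂ ↦ u₂ + u₁; 1/3, 1/3, w, 1/6)`, `0 < w < 1/6`, has
the twist `Φ₁ = φ ∉ k[u₁ + u₂] = k[T] ∩ k[u]`.)
[cite: CossartJannsenSaito2020, Thm. 8.16 (p. 121), Def. 8.13 (pp. 120–121), Thm. 8.22 (a) (p. 124), Thm. 8.24 (p. 125); Hironaka1967, Thm. (4.8)] -/
theorem uHomogeneousPart_mem_linearFormsSubalgebra_of_disjoint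
    (hord : monomialOrd (fun _ => 1) f = ν)
    (hτ : S.card = hironakaTau k {homogeneousComponent ν f})
    (hFS : ∀ d ∈ (homogeneousComponent ν f).support, ∀ j ∉ S, d j = 0)
    (hprep : IsDeltaPrepared S ν f) {δ : ℚ} (hδ : hironakaDelta S ν f = δ)
    (hind : LinearIndependent k fun l : ↥S => pderiv (l : Fin n) (homogeneousComponent ν f))
    (hN : Disjoint (Submodule.span k (Set.range fun l : ↥S => pderiv (l : Fin n) (homogeneousComponent ν f)))
      (Submodule.span k (Set.range (predFaceSlice S ν δ f))))
    {Ψ : MvPolynomial (Fin n) k ≃ₐ[k] MvPolynomial (Fin n) k} {γ : Fin n → ℚ}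
    (h : IsCentreFor f Ψ γ) (hγS : ∀ i ∈ S, γ i = (ν : ℚ)⁻¹)
    (hγle : ∀ j ∉ S, γ j ≤ ((ν : ℚ) * δ)⁻¹) :
    ∀ i ∈ S, uHomogeneousPart S δ (Ψ (X i)) ∈
      linearFormsSubalgebra k (competitorSpan S ν δ Ψ γ) := by
  classical
  have hν : 0 < ν := nu_pos_of_hironakaDelta_eq hδ
  obtain ⟨m, rfl⟩ := Nat.exists_eq_add_one_of_ne_zero hν.ne'
  have hδ1 : 1 < δ := one_lt_hironakaDelta hord hFS hδ
  have hδpos : 0 < δ := one_pos.trans hδ1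
  obtain ⟨p, q, hqpos, hpq⟩ := exists_eq_mul_den hδpos
  have hqq : (0 : ℚ) < q := by exact_mod_cast hqpos
  have hqp : q < p := by
    have : (q : ℚ) < p := by rw [hpq]; nlinarith
    exact_mod_cast this
  have hppos : 0 < p := lt_of_le_of_lt (Nat.zero_le _) hqp
  obtain ⟨h1, h2, -, -⟩ :=
    deltaInitial_eq_aeval_of_isCentreFor hord hτ hFS hprep hδ hqpos hpq h hγS hγle
  set A := linearFormsSubalgebra k (competitorSpan S (m + 1) δ Ψ γ) with hA
  set Φ : Fin n → MvPolynomial (Fin n) k := fun i => uHomogeneousPart S δ (Ψ (X i)) with hΦdef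
  set Lin : Fin n → MvPolynomial (Fin n) k := fun i =>
    if i ∈ S then ∑ l ∈ S, C (coeff (Finsupp.single l 1) (Ψ (X i))) * X l else 0 with hLin
  set L : Fin n → MvPolynomial (Fin n) k := fun j => linearFormPoly k (uLinearForm S (Ψ (X j)))
    with hL
  set Hc := weightedHomogeneousComponent (fun i => if i ∈ S then p else q) ((m + 1) * p) (Ψ.symm f)
    with hHc
  set θ : Fin n → MvPolynomial (Fin n) k := fun i => weightedHomogeneousComponent
    (fun j => if j ∈ S then p else q) (if i ∈ S then p else q) (Ψ (X i)) with hθ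
  have hθS : ∀ i ∈ S, θ i = Lin i + Φ i := fun i hi => by
    simp only [hθ, hLin, if_pos hi]
    rw [weightedHomogeneousComponent_high_eq hqp hqpos hpq]
  have hθj : ∀ j, j ∉ S → θ j = L j := fun j hjS => by
    simp only [hθ, hL, if_neg hjS]
    exact weightedHomogeneousComponent_low_eq hqp hqpos _
  -- the two gradings: `w'` = `X_S`-degree, `w''` = `u`-degree
  set w' : Fin n → ℕ := fun i => if i ∈ S then 1 else 0 with hw'
  set w'' : Fin n → ℕ := fun i => if i ∈ S then 0 else 1 with hw''
  have hLinhom : ∀ i, IsWeightedHomogeneous w' (Lin i) 1 := by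
    intro i
    simp only [hLin]
    split_ifs with hi
    · refine IsWeightedHomogeneous.sum _ _ 1 fun l hl => ?_
      have := (isWeightedHomogeneous_X k w' l).C_mul (coeff (Finsupp.single l 1) (Ψ (X i)))
      simpa [hw', hl] using this
    · exact isWeightedHomogeneous_zero k w' 1
  have hLinU : ∀ Q : MvPolynomial (Fin n) k, IsWeightedHomogeneous w'' (aeval Lin Q) 0 := by
    have hgen : ∀ i, IsWeightedHomogeneous w'' (Lin i) 0 := by
      intro i
      simp only [hLin]
      split_ifs with hi
      · refine IsWeightedHomogeneous.sum _ _ 0 fun l hl => ?_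
        have := (isWeightedHomogeneous_X k w'' l).C_mul (coeff (Finsupp.single l 1) (Ψ (X i)))
        simpa [hw'', hl] using this
      · exact isWeightedHomogeneous_zero k w'' 0
    intro Q
    induction Q using MvPolynomial.induction_on with
    | C a => rw [aeval_C, algebraMap_eq]; exact isWeightedHomogeneous_C w'' a
    | add p' q' hp hq => rw [map_add]; exact hp.add hq
    | mul_X p' i hp => rw [map_mul, aeval_X, ← add_zero (0 : ℕ)]; exact hp.mul (hgen i)
  have hΦhom : ∀ i, IsWeightedHomogeneous w' (Φ i) 0 := by
    intro i d hd
    simp only [hΦdef, uHomogeneousPart, coeff_sum_filter_monomial] at hd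
    have hPd : blockDeg S d = 0 ∧ (d.degree : ℚ) = δ := by
      by_contra h'; exact hd (if_neg h')
    rw [hw', weight_block, hPd.1]; simp
  have hLhom : ∀ j, IsWeightedHomogeneous w' (L j) 0 := by
    intro j
    simp only [hL]
    rw [linearFormPoly_uLinearForm]
    refine IsWeightedHomogeneous.sum _ _ 0 fun l hl => ?_
    have hl : l ∉ S := (Finset.mem_filter.mp hl).2
    have := (isWeightedHomogeneous_X k w' l).C_mul (coeff (Finsupp.single l 1) (Ψ (X j)))
    simpa [hw', hl] using this
  set U : (Fin n →₀ ℕ) → MvPolynomial (Fin n) k :=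
    fun d => ∏ j ∈ Finset.univ.filter (· ∉ S), L j ^ d j with hU
  have hUhom : ∀ d, IsWeightedHomogeneous w' (U d) 0 := by
    intro d
    have := IsWeightedHomogeneous.prod (Finset.univ.filter (· ∉ S)) (fun j => L j ^ d j)
      (fun _ => 0) fun j _ => by simpa using (hLhom j).pow (d j)
    simpa using this
  have hU1 : ∀ d : Fin n →₀ ℕ, coDeg S d = 0 → U d = 1 := fun d hd => by
    rw [coDeg_eq_sum_univ, Finset.sum_eq_zero_iff] at hd
    exact Finset.prod_eq_one fun j hj => by rw [hd j hj, pow_zero]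
  have hUmem : ∀ d ∈ Hc.support, U d ∈ A := by
    intro d hd
    refine prod_mem fun j hj => ?_
    have hjS : j ∉ S := (Finset.mem_filter.mp hj).2
    by_cases hdj : d j = 0
    · rw [hdj, pow_zero]; exact one_mem _
    · have hγj : γ j = (((m + 1 : ℕ) : ℚ) * δ)⁻¹ := by
        by_contra hne; exact hdj (h2 d hd j hjS hne)
      exact pow_mem (uLinearForm_mem_linearFormsSubalgebra_competitorSpan hjS hγj) _
  -- expansion of `aeval θ Hc`
  have hSfilter : Finset.univ.filter (· ∈ S) = S := by ext i; simp
  have hexp : aeval θ Hc =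
      ∑ d ∈ Hc.support, C (coeff d Hc) * ((∏ i ∈ S, (Lin i + Φ i) ^ d i) * U d) := by
    rw [MvPolynomial.aeval_def, MvPolynomial.eval₂_eq']
    refine Finset.sum_congr rfl fun d _ => ?_
    rw [MvPolynomial.algebraMap_eq,
      ← Finset.prod_filter_mul_prod_filter_not Finset.univ (· ∈ S), hSfilter]
    congr 2
    · exact Finset.prod_congr rfl fun i hi => by rw [hθS i hi]
    · exact Finset.prod_congr rfl fun j hj => by rw [hθj j (Finset.mem_filter.mp hj).2]
  have hcomp : ∀ t, weightedHomogeneousComponent w' t (aeval θ Hc) =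
      ∑ d ∈ Hc.support, C (coeff d Hc) *
        (weightedHomogeneousComponent w' t (∏ i ∈ S, (Lin i + Φ i) ^ d i) * U d) := by
    intro t
    rw [hexp, map_sum]
    refine Finset.sum_congr rfl fun d _ => ?_
    rw [weightedHomogeneousComponent_C_mul,
      weightedHomogeneousComponent_mul_of_isWeightedHomogeneous_zero (hUhom d)]
  -- the support of `Hc`
  have hHcw : ∀ d ∈ Hc.support, p * blockDeg S d + q * coDeg S d = (m + 1) * p := by
    intro d hd
    rw [mem_support_iff, hHc, coeff_weightedHomogeneousComponent] at hd
    have : weight (fun i => if i ∈ S then p else q) d = (m + 1) * p := by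
      by_contra hne; exact hd (if_neg hne)
    rwa [weight_block] at this
  have hbν : ∀ d ∈ Hc.support, blockDeg S d ≤ m + 1 := by
    intro d hd
    have := hHcw d hd
    have h1 : p * blockDeg S d ≤ p * (m + 1) := by rw [Nat.mul_comm p (m + 1)]; omega
    exact Nat.le_of_mul_le_mul_left h1 hppos
  have hco0 : ∀ d ∈ Hc.support, blockDeg S d = m + 1 → coDeg S d = 0 := by
    intro d hd hb
    have := hHcw d hd
    rw [hb, Nat.mul_comm p (m + 1)] at this
    have h0 : q * coDeg S d = 0 := by omega
    rcases Nat.mul_eq_zero.mp h0 with h | h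
    · omega
    · exact h
  have hsuppS : ∀ d ∈ Hc.support, blockDeg S d = m + 1 → ∀ j ∉ S, d j = 0 := by
    intro d hd hb j hj
    have := hco0 d hd hb
    rw [coDeg_eq_sum_univ, Finset.sum_eq_zero_iff] at this
    exact this j (Finset.mem_filter.mpr ⟨Finset.mem_univ _, hj⟩)
  have hbS : ∀ d : Fin n →₀ ℕ, ∑ i ∈ S, d i = blockDeg S d := fun d =>
    (blockDeg_eq_sum_univ S d).symm
  -- `H_ν` and the transported initial form
  set T := Hc.support.filter (fun d => blockDeg S d = m + 1) with hT
  set Hν := ∑ d ∈ T, monomial d (coeff d Hc) with hHν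
  have hTsupp : ∀ d ∈ T, ∀ j ∉ S, d j = 0 := fun d hd =>
    hsuppS d (Finset.mem_filter.mp hd).1 (Finset.mem_filter.mp hd).2
  have haevalHν : aeval Lin Hν = ∑ d ∈ T, C (coeff d Hc) * ∏ i ∈ S, Lin i ^ d i := by
    rw [hHν, map_sum]
    exact Finset.sum_congr rfl fun d hd => aeval_monomial_of_supported Lin (hTsupp d hd) _
  -- degree `m + 1`: `in_ν f = H_ν(Lin)`
  have hF : homogeneousComponent (m + 1) f = aeval Lin Hν := by
    rw [← weightedHomogeneousComponent_indicator_deltaInitial_eq hFS, h1, hcomp (m + 1),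
      haevalHν, hT, Finset.sum_filter]
    refine Finset.sum_congr rfl fun d hd => ?_
    by_cases hb : blockDeg S d = m + 1
    · rw [if_pos hb, ← hb, ← hbS d,
        weightedHomogeneousComponent_prod_top Lin Φ (⇑d) S (fun i _ => hLinhom i)
          (fun i _ => hΦhom i), hU1 d (hco0 d hd hb), mul_one]
    · rw [if_neg hb, weightedHomogeneousComponent_prod_eq_zero_of_lt Lin Φ (⇑d) S
        (fun i _ => hLinhom i) (fun i _ => hΦhom i) (by rw [hbS]; have := hbν d hd; omega),
        zero_mul, mul_zero]
  -- degree `m`: `0 = Σ_i Φ_i (∂_i H_ν)(Lin) + Rest`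
  set D : Fin n → MvPolynomial (Fin n) k := fun i => aeval Lin (pderiv i Hν) with hD
  set Rest := ∑ d ∈ Hc.support.filter (fun d => blockDeg S d = m),
    C (coeff d Hc) * ((∏ i ∈ S, Lin i ^ d i) * U d) with hRest
  have hslice : ∑ i ∈ S, D i * Φ i + Rest =
      ∑ d ∈ f.support with (blockDeg S d + 1 = m + 1 ∧ (coDeg S d : ℚ) = δ), monomial d (coeff d f) := by
    have hE := hcomp m
    rw [← h1, weightedHomogeneousComponent_indicator_deltaInitial_eq_sum] at hE
    -- split the sum according to `blockDeg S d ∈ {m + 1, m, < m}`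
    have hterm : ∀ d ∈ Hc.support, C (coeff d Hc) *
        (weightedHomogeneousComponent w' m (∏ i ∈ S, (Lin i + Φ i) ^ d i) * U d) =
        (if blockDeg S d = m + 1 then C (coeff d Hc) *
          ∑ i ∈ S, d i • (Φ i * Lin i ^ (d i - 1) * ∏ j ∈ S.erase i, Lin j ^ d j) else 0) +
        (if blockDeg S d = m then C (coeff d Hc) * ((∏ i ∈ S, Lin i ^ d i) * U d) else 0) := by
      intro d hd
      by_cases hb : blockDeg S d = m + 1
      · rw [if_pos hb, if_neg (by omega),
          weightedHomogeneousComponent_prod_next Lin Φ (⇑d) S (fun i _ => hLinhom i)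
            (fun i _ => hΦhom i) (by rw [hbS, hb]), hU1 d (hco0 d hd hb), mul_one, add_zero]
      · by_cases hb' : blockDeg S d = m
        · rw [if_neg hb, if_pos hb', zero_add, ← hb', ← hbS d,
            weightedHomogeneousComponent_prod_top Lin Φ (⇑d) S (fun i _ => hLinhom i)
              (fun i _ => hΦhom i)]
        · rw [if_neg hb, if_neg hb', add_zero,
            weightedHomogeneousComponent_prod_eq_zero_of_lt Lin Φ (⇑d) S (fun i _ => hLinhom i)
              (fun i _ => hΦhom i) (by rw [hbS]; have := hbν d hd; omega), zero_mul, mul_zero]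
    rw [Finset.sum_congr rfl hterm, Finset.sum_add_distrib, ← Finset.sum_filter,
      ← Finset.sum_filter] at hE
    rw [hE]
    congr 1
    have key := sum_taylor_terms_eq Lin Φ T (fun d => coeff d Hc) hTsupp
    rw [← hT, key]
    exact Finset.sum_congr rfl fun i _ => mul_comm _ _
  -- the `∂_l in_ν f` lie in the span of the `D_i`, `i ∈ S` (chain rule)
  have hle : ∀ l : ↥S, pderiv (l : Fin n) (homogeneousComponent (m + 1) f) ∈
      Submodule.span k (Set.range fun i : ↥S => D i) := by
    intro l
    have hchain : pderiv (l : Fin n) (homogeneousComponent (m + 1) f) =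
        ∑ i ∈ S, coeff (Finsupp.single (l : Fin n) 1) (Ψ (X i)) • D i := by
      rw [hF, pderiv_aeval_eq_sum, ← Finset.sum_filter_add_sum_filter_not Finset.univ (· ∈ S),
        hSfilter, Finset.sum_eq_zero (s := Finset.univ.filter (· ∉ S)) fun j hj => by
          simp only [hLin, if_neg (Finset.mem_filter.mp hj).2, map_zero, mul_zero], add_zero]
      refine Finset.sum_congr rfl fun i hi => ?_
      simp only [hD, hLin, if_pos hi, map_sum, pderiv_C_mul, pderiv_X, Pi.single_apply]
      rw [Finset.sum_eq_single (l : Fin n) (fun l' _ hl' => by rw [if_neg hl', mul_zero])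
        (fun hl => absurd l.2 hl), if_pos rfl, mul_one, smul_eq_C_mul, mul_comm]
    rw [hchain]
    refine Submodule.sum_mem _ fun i hi => Submodule.smul_mem _ _ ?_
    exact Submodule.subset_span ⟨⟨i, hi⟩, rfl⟩
  -- extraction: a functional dual to the `D_i` that kills every `N_e`
  intro i₁ hi₁
  obtain ⟨g, hg, hgW⟩ := exists_dual_eq_ite_of_disjoint
    (Submodule.span k (Set.range (predFaceSlice S (m + 1) δ f))) hind hN hle ⟨i₁, hi₁⟩
  set FIN := (S.biUnion fun i => (D i).support) ∪
    (f.support.filter fun d => blockDeg S d + 1 = m + 1 ∧ (coDeg S d : ℚ) = δ).image (sPart S)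
    with hFIN
  set Eg : MvPolynomial (Fin n) k →ₗ[k] MvPolynomial (Fin n) k :=
    ∑ B ∈ FIN, g (monomial B 1) • coeffAlong S B with hEg
  have hEg_apply : ∀ P, Eg P = ∑ B ∈ FIN, g (monomial B 1) • coeffAlong S B P := fun P => by
    simp only [hEg, LinearMap.sum_apply, LinearMap.smul_apply]
  have hDsupp : ∀ i, ∀ d ∈ (D i).support, uPart S d = 0 := fun i =>
    uPart_eq_zero_of_isWeightedHomogeneous (hLinU _)
  have hΦsupp : ∀ i, ∀ d ∈ (Φ i).support, sPart S d = 0 := fun i =>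
    sPart_eq_zero_of_isWeightedHomogeneous (hΦhom i)
  have hEgPQ : ∀ P Q : MvPolynomial (Fin n) k, (∀ d ∈ P.support, uPart S d = 0) →
      (∀ d ∈ Q.support, sPart S d = 0) → P.support ⊆ FIN → Eg (P * Q) = g P • Q := by
    intro P Q hP hQ hPF
    rw [hEg_apply]
    simp_rw [coeffAlong_mul_of_supported S hP hQ, smul_smul]
    rw [← Finset.sum_smul]
    congr 1
    have hPe : P = ∑ B ∈ FIN, coeff B P • (monomial B (1 : k)) := by
      conv_lhs => rw [P.as_sum]
      rw [Finset.sum_subset hPF]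
      · exact Finset.sum_congr rfl fun B _ => by rw [smul_monomial, smul_eq_mul, mul_one]
      · intro B _ hB
        rw [notMem_support_iff.mp hB, monomial_zero]
    conv_rhs => rw [hPe, map_sum]
    refine Finset.sum_congr rfl fun B _ => ?_
    rw [map_smul, smul_eq_mul, mul_comm]
  have hEgD : ∀ i ∈ S, Eg (D i * Φ i) = g (D i) • Φ i := fun i hi =>
    hEgPQ (D i) (Φ i) (hDsupp i) (hΦsupp i)
      ((Finset.subset_biUnion_of_mem (fun i => (D i).support) hi).trans Finset.subset_union_left)
  have hEgN : Eg (∑ d ∈ f.support with (blockDeg S d + 1 = m + 1 ∧ (coDeg S d : ℚ) = δ),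
      monomial d (coeff d f)) = 0 := by
    rw [sum_filter_eq_sum_predFaceSlice, map_sum]
    refine Finset.sum_eq_zero fun e he => ?_
    obtain ⟨d₀, -, hd₀⟩ := Finset.mem_image.mp he
    rw [hEgPQ _ _ (fun d hd => uPart_eq_zero_of_mem_support_predFaceSlice hd)
      (fun d hd => by rw [Finset.mem_singleton.mp (support_monomial_subset hd), ← hd₀]; exact sPart_uPart d₀)
      ((support_predFaceSlice_subset e).trans Finset.subset_union_right),
      hgW _ (Submodule.subset_span ⟨e, rfl⟩), zero_smul]
  have hEgRest : Eg Rest ∈ A := by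
    rw [hEg_apply]
    refine Subalgebra.sum_mem _ fun B _ => Subalgebra.smul_mem _ ?_ _
    rw [hRest, map_sum]
    refine Subalgebra.sum_mem _ fun d hd => ?_
    have hd' : d ∈ Hc.support := (Finset.mem_filter.mp hd).1
    rw [← mul_assoc, coeffAlong_mul_of_supported S ?_ (sPart_eq_zero_of_isWeightedHomogeneous
      (hUhom d))]
    · exact Subalgebra.smul_mem _ (hUmem d hd') _
    · apply uPart_eq_zero_of_isWeightedHomogeneous
      rw [← zero_add (0 : ℕ)]
      refine (isWeightedHomogeneous_C w'' _).mul ?_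
      have := IsWeightedHomogeneous.prod S (fun i => Lin i ^ d i) (fun _ => 0)
        fun i _ => by simpa using ((hLinU (X i)).pow (d i))
      simpa [aeval_X] using this
  have hg' : ∀ i ∈ S, g (D i) = if i = i₁ then 1 else 0 := fun i hi => by
    have := hg ⟨i, hi⟩
    simp only [Subtype.mk.injEq] at this
    exact this
  have hfinal : Φ i₁ + Eg Rest = 0 := by
    have := congr_arg Eg hslice
    rw [hEgN, map_add, map_sum, Finset.sum_congr rfl hEgD] at this
    rw [← this]
    congr 1
    rw [Finset.sum_eq_single i₁ (fun i hi hne => by rw [hg' i hi, if_neg hne, zero_smul])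
      (fun h' => absurd hi₁ h'), hg' i₁ hi₁, if_pos rfl, one_smul]
  have : Φ i₁ = -Eg Rest := eq_neg_of_add_eq_zero_left hfinal
  rw [show uHomogeneousPart S δ (Ψ (X i₁)) = Φ i₁ from rfl, this]
  exact neg_mem hEgRest

/-- **The count for general `τ` under (IND) + (N0_W).** Under `δ`-preparedness, (IND) and (N0_W) as in
`uHomogeneousPart_mem_linearFormsSubalgebra_of_disjoint`: every centre `(Ψ; γ)` for `f` with
`γ = 1/ν` on `S` and `γ ≤ 1/(νδ)` off `S` satisfies `τ(in_δ f) ≤ |S| + #{j ∉ S : γ_j = 1/(νδ)}` — at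
least `τ(in_δ f) − τ` further weights EQUAL `1/(νδ)`. (Ours, in the model; for `τ ≥ 2` neither
hypothesis can be dropped even when `p ∤ ν`: over `𝔽₂` with `ν = 3`, `φ = u₁² + u₁u₂ + u₂²`,
`r = (u₁ + u₂)⁴`, the `δ`-prepared `f = y₁²y₂ + y₂φ² + y₁r + φr` ((N0) holds, (IND) fails) and
`f = (y₁ + φ)³ + y₂³ + y₂(u₁ + u₂)²(y₁ + φ)` ((IND) holds, (N0_W) fails) both have `δ = 2`,
`τ(in_δ f) = 4`, and `Ψ⁻¹ : y₁ ↦ y₁ + φ, u₂ ↦ u₂ + u₁` gives `y₁²y₂ + y₁u₂⁴` resp.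
`y₁³ + y₂³ + y₁y₂u₂²`, admissible for `(1/3, 1/3, w, 1/6)`, every `0 < w < 1/6`: ONE `u`-weight
`1/(νδ)` where the count demands two.)
[cite: CossartJannsenSaito2020, Thm. 8.16 (p. 121), Def. 8.2 (4) (p. 118), Def. 8.13 (pp. 120–121); AbramovichTemkinWlodarczyk2024, Thm. 5.3.1 (p. 1578); AbramovichQuekSchober2025, Thm. 3.5] -/
theorem hironakaTau_deltaInitial_le_of_disjoint
    (hord : monomialOrd (fun _ => 1) f = ν)
    (hτ : S.card = hironakaTau k {homogeneousComponent ν f})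
    (hFS : ∀ d ∈ (homogeneousComponent ν f).support, ∀ j ∉ S, d j = 0)
    (hprep : IsDeltaPrepared S ν f) {δ : ℚ} (hδ : hironakaDelta S ν f = δ)
    (hind : LinearIndependent k fun l : ↥S => pderiv (l : Fin n) (homogeneousComponent ν f))
    (hN : Disjoint (Submodule.span k (Set.range fun l : ↥S => pderiv (l : Fin n) (homogeneousComponent ν f)))
      (Submodule.span k (Set.range (predFaceSlice S ν δ f))))
    {Ψ : MvPolynomial (Fin n) k ≃ₐ[k] MvPolynomial (Fin n) k} {γ : Fin n → ℚ}
    (h : IsCentreFor f Ψ γ) (hγS : ∀ i ∈ S, γ i = (ν : ℚ)⁻¹)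
    (hγle : ∀ j ∉ S, γ j ≤ ((ν : ℚ) * δ)⁻¹) :
    hironakaTau k {deltaInitial S ν δ f} ≤
      S.card + (Finset.univ.filter (fun j => j ∉ S ∧ γ j = ((ν : ℚ) * δ)⁻¹)).card :=
  hironakaTau_deltaInitial_le_of_isCentreFor hord hτ hFS hprep hδ h hγS hγle
    (uHomogeneousPart_mem_linearFormsSubalgebra_of_disjoint hord hτ hFS hprep hδ hind hN h hγS hγle)

/-- (N0) ⇒ (N0_W): if the `δ`-face of `f` carries no monomial of `y`-degree `ν − 1`, every slice
`N_e` is `0` and the disjointness is trivial. (Ours, elementary.)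
[cite: CossartJannsenSaito2020, Def. 8.2 (4) (p. 118)] -/
theorem disjoint_span_pderiv_predFaceSlice_of_forall_ne {δ : ℚ}
    (hN0 : ∀ d ∈ f.support, blockDeg S d + 1 = ν → (coDeg S d : ℚ) ≠ δ) :
    Disjoint (Submodule.span k (Set.range fun l : ↥S => pderiv (l : Fin n) (homogeneousComponent ν f)))
      (Submodule.span k (Set.range (predFaceSlice S ν δ f))) := by
  classical
  have h0 : ∀ e, predFaceSlice S ν δ f e = 0 := fun e => by
    rw [predFaceSlice]
    exact Finset.sum_eq_zero fun d hd => by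
      obtain ⟨hd, ⟨hb, hc⟩, -⟩ := Finset.mem_filter.mp hd
      exact absurd hc (hN0 d hd hb)
  have : Submodule.span k (Set.range (predFaceSlice S ν δ f)) = ⊥ := by
    rw [Submodule.span_eq_bot]
    rintro _ ⟨e, rfl⟩
    exact h0 e
  rw [this]
  exact disjoint_bot_right

end NormalisedFace

end WeightedBlowup

end Literature.AlgebraicGeometry.Resolution
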